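import Summits.QuantumFields.YangMills.Theorems.FluctuationComparisonRegPrIntLOrganTangentSupportSegmentLipschitz
import HarnessLib

/-!
# Crux `FluctuationComparisonRegPrIntL` (stmt-QuantumFields-20520, rung R3), PATH-B organ, H-currency cone — (L44b) «SUPPORT EDITION»: (W-Lip) of ✓(L38) — hence the REG′ halves of
# all four A2′ (I-law) blocks — FROM THE FRAME + THE ROW'S OWN (β) + THREE CHART LETTERS ASKED ONLY ON PARAMETER SEGMENTS WHOSE INTERIOR MAPS INTO THE MULTI-WINDOW GOOD SET

Cell `ym3-torus` (YM ladder rung R3 = continuum `SU(2)` Yang–Mills on the three-torus — a RUNG: NOT d = 4, NOT infinite volume, NOT a mass gap, NOT Clay).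
Width seat `ym-ust-20520-w5` (gen 25), `--kind proof --supports stmt-QuantumFields-20520 --as helper`, count-neutral, DEFINITION-FREE, default heartbeats,
no registry ∕ binder ∕ `Lines/` edit.  Over ✓(L44a) `…OrganTangentSupportSegmentLipschitz` (`lipschitzOnWith_of_continuousOn_of_openSeg`, `continuousOn_wNum_relPath∕relSquare`),
✓p823227 `…WeightLipOfChartLettersSeg` (`lipschitzOnWith_wNum_of_chartLetters_seg`), ✓p823184 `…LogDensitySegLipOfBeta` (`abs_sub_le_of_beta_of_localIncr_seg`), ✓p822554
(`exists_abs_log_le_of_plaq_le`), ✓p822302 (`mwCut_ne_zero_of_wNum_ne_zero`).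

WHY.  Bałaban's minimiser-following chart is regular where the fine field is small — on the multi-window GOOD SET `MW := {U | ∀ j < n ≤ Ts, PlaqSmall (24∕25·θ_n) (descendTo n Ts U)}`
(the cut's positivity set) — and nowhere else need it be.  By ✓(L44a) the interpolated weight `s ↦ wNum_t (X s) z` is CONTINUOUS on `Ioo (-1) 2` from the frame, and a continuous
function that is Lipschitz across every open parameter segment free of its zeros is Lipschitz; on such a segment the fine curve `s ↦ Φ (X s, z)` runs INSIDE `MW`.  So the three
chart-primitive letters of ✓(L39b)∕(L42b) may be asked ONLY on closed parameter segments `uIcc x y` (within `Ioo (-1) 2`) whose INTERIOR `uIoo x y` is mapped into `MW` — the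
D0 «MINIMISER CHART» typer's natural domain (no off-good-set convention, cf. TN-HDISP-FRAME (iii)).

WHAT.  ★★★`weightLip_of_beta_of_goodSetLetters`: `∃ bW : ℝ, ∀ t ∈ [0,1]`, BOTH (W-Lip) clauses of ✓p822302 VERBATIM (near relational PATHS and SQUARE `s`-edges, `∀ᵐ z ∂τ`), FROM:
the frame (`hρc hρ'c hρpos`, `hθ` all levels, `hχc`, `hχsupp`, the chart block's window-continuity clause [7] VERBATIM, `J ≤ CJ`, guard), the ROW-PREFIX (β) texts at level `Ts` for
`ρ_Ts` (bound `Bρ`) and `ρ′_Ts` (bound `Bρ′`), and, for every near path ∕ square edge, every fibre point `z` and every `x, y ∈ Ioo (-1) 2` with `∀ r ∈ uIoo x y, Φ (X r, z) ∈ MW`: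
(Φ-disp-Lip∣MW) ONE modulus `D` for `s ↦ dist1 (plaqHol (descendTo n Ts (Φ (X s, z))) p)` on `Ioo (-1) 2 ∩ uIcc x y`, every level `j < n ≤ Ts`; (J-Lip∣MW) a modulus `KJ` for
`s ↦ J (X s, z)` there; (Φ-bond-incr-loc∣MW) LOCAL bondwise exponential increments there (pairs at distance `≤ δ`; speeds `k ≥ 0`, `Σ k ≤ K`); rows `k e·δ ≤ μ`, `4·(√3·μ) ≤ θ_Ts∕50`,
`μ < rA·(49∕50·θ_Ts)` (`δ, μ` free).  NET, BY KERNEL: REG′ ×4 ⟸ (β)×2 [row] + frame + {(Φ-disp-Lip∣MW) (its n = Ts part is `hdisp` re-based, ✓p823035), (Φ-bond-incr-loc∣MW), (J-Lip∣MW)}.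

HONEST FRAMING: [folklore] real analysis over HYPOTHESIS letters; (β), `hdisp`, the window-continuity clause are ROW∕FRAME HYPOTHESES; the three ∣MW letters are D0∕(P1) chart material
on the good set — nothing here constructs the chart; nothing of Bałaban's analysis is asserted or proved; KER′, (I-curv), (I-cov), `hdisp_n` OPEN; `OrganDischargeInputsHJ(sq)` ∕
`SpreadFibreLawH(J)(sq)` UNDISCHARGED; the five registered stubs of `Lines/semiclassical_s2beta.lean`, crux 20520 and `YM3TorusSU2` are NOT proved; registry untouched; rung R3 = SU(2)
YM₃ on T³ — NOT d = 4, NOT infinite volume, NOT a mass gap, NOT Clay; the Yang–Mills mass gap is NOT proved.  [folklore]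
-/

set_option autoImplicit false

noncomputable section

namespace Summit.QuantumFields.YangMills.Theorems.OrganTangentWeightLipOfGoodSetLetters

open MeasureTheory Filter Topology Set Function
open scoped ENNReal NNReal BigOperators
open Literature.MathematicalPhysics.QuantumFieldTheory.Balaban1983to89 T3ContinuumYM3Torus T3NestedUnitLaws T3UnitLawDensityEML T4Continuum BalabanUVClass
  T3UnitScaleTilt T3LevelShift T3TiltDescent
open T4CubeChartExp (expPt)
open Summit.QuantumFields.YangMills.Theorems.FluctuationComparisonRegPrIntLRunpairOrganFibreLaw (mwCut wNum)
open Summit.QuantumFields.YangMills.Theorems.OrganTangentWeightLipOfChartLetters (exists_abs_log_le_of_plaq_le)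
open Summit.QuantumFields.YangMills.Theorems.OrganTangentWeightLipOfChartLettersSeg (lipschitzOnWith_wNum_of_chartLetters_seg)
open Summit.QuantumFields.YangMills.Theorems.OrganTangentLogDensitySegLipOfBeta (abs_sub_le_of_beta_of_localIncr_seg)
open Summit.QuantumFields.YangMills.Theorems.OrganTangentILawRegOfWeightLip (mwCut_ne_zero_of_wNum_ne_zero)
open Summit.QuantumFields.YangMills.Theorems.OrganTangentSupportSegmentLipschitz

/-! ## §1 One fine curve on a convex parameter set: Lipschitz of the weight from continuity + letters on good-interior segments -/

section Curve

variable (F : T3Family) (γ b₀ p₀ : ℝ) (j Ts : ℕ)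

/-- ★★ **THE WEIGHT ALONG A COARSE CURVE, SUPPORT EDITION** — for a coarse curve `C` and a fibre point `z` with `s ↦ wNum_t (C s) z` CONTINUOUS on the convex `I`: if on every closed
sub-segment `I ∩ uIcc x y` whose interior maps into `MW` the three chart letters hold ((Φ-disp-Lip) `D`, (J-Lip) `KJ`, LOCAL increments with speeds `k`) and the (β) texts hold for
`ρ_Ts, ρ′_Ts`, then `s ↦ wNum_t (C s) z` is Lipschitz on `I` with an explicit curve∕fibre∕`t`-free modulus. [folklore] -/
theorem lipschitzOnWith_wNum_of_goodSetLetters (hjTs : j + 1 ≤ Ts)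
    (ρ ρ' : (i : ℕ) → GaugeField (F.P i) 0 ↥(Matrix.specialUnitaryGroup (Fin 2) ℂ) → ℝ)
    (hρpos : ∀ U, PlaqSmall (θBal F.L γ b₀ p₀ Ts) U → 0 < ρ Ts U ∧ 0 < ρ' Ts U) (hθ : ∀ n, 0 < θBal F.L γ b₀ p₀ n)
    (ML ML' : ℝ) (hML : ∀ U, (∀ p, dist1 (GaugeField.plaqHol U p) ≤ 24 / 25 * θBal F.L γ b₀ p₀ Ts) → |Real.log (ρ Ts U)| ≤ ML)
    (hML' : ∀ U, (∀ p, dist1 (GaugeField.plaqHol U p) ≤ 24 / 25 * θBal F.L γ b₀ p₀ Ts) → |Real.log (ρ' Ts U)| ≤ ML')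
    (hχsupp : ∀ U, mwCut F γ b₀ p₀ j Ts U ≠ 0 → ∀ (n : ℕ) (hjn : j + 1 ≤ n) (hnK : n ≤ Ts), PlaqSmall (24 / 25 * θBal F.L γ b₀ p₀ n) (descendTo F ℰp n Ts hnK U))
    (rA Bρ Bρ' : ℝ) (hrA : 0 < rA)
    (hβ : ∀ (U : GaugeField (F.P Ts) 0 ↥(Matrix.specialUnitaryGroup (Fin 2) ℂ)), PlaqSmall (49 / 50 * θBal F.L γ b₀ p₀ Ts) U →
      ∀ (b b' : PBond (F.P Ts) 0) (v v' : Fin 3 → ℝ), ‖v‖ ≤ 1 → ‖v'‖ ≤ 1 →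
        ∃ g : ℂ × ℂ → ℂ, DifferentiableOn ℂ g (Metric.ball (0 : ℂ) (rA * (49 / 50 * θBal F.L γ b₀ p₀ Ts)) ×ˢ Metric.ball (0 : ℂ) (rA * (49 / 50 * θBal F.L γ b₀ p₀ Ts))) ∧
          (∀ (s t : ℝ) (V Z : GaugeField (F.P Ts) 0 ↥(Matrix.specialUnitaryGroup (Fin 2) ℂ)), |s| < rA * (49 / 50 * θBal F.L γ b₀ p₀ Ts) → |t| < rA * (49 / 50 * θBal F.L γ b₀ p₀ Ts) →
            (∀ e, e ≠ b → V e = U e) → V b = U b * expPt (s • v) → (∀ e, e ≠ b' → Z e = V e) → Z b' = V b' * expPt (t • v') →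
            g ((s : ℂ), (t : ℂ)) = (((Real.log (ρ Ts Z)) : ℝ) : ℂ)) ∧
          ∀ z ∈ Metric.ball (0 : ℂ) (rA * (49 / 50 * θBal F.L γ b₀ p₀ Ts)) ×ˢ Metric.ball (0 : ℂ) (rA * (49 / 50 * θBal F.L γ b₀ p₀ Ts)), ‖g z - g 0‖ ≤ Bρ)
    (hβ' : ∀ (U : GaugeField (F.P Ts) 0 ↥(Matrix.specialUnitaryGroup (Fin 2) ℂ)), PlaqSmall (49 / 50 * θBal F.L γ b₀ p₀ Ts) U →
      ∀ (b b' : PBond (F.P Ts) 0) (v v' : Fin 3 → ℝ), ‖v‖ ≤ 1 → ‖v'‖ ≤ 1 →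
        ∃ g : ℂ × ℂ → ℂ, DifferentiableOn ℂ g (Metric.ball (0 : ℂ) (rA * (49 / 50 * θBal F.L γ b₀ p₀ Ts)) ×ˢ Metric.ball (0 : ℂ) (rA * (49 / 50 * θBal F.L γ b₀ p₀ Ts))) ∧
          (∀ (s t : ℝ) (V Z : GaugeField (F.P Ts) 0 ↥(Matrix.specialUnitaryGroup (Fin 2) ℂ)), |s| < rA * (49 / 50 * θBal F.L γ b₀ p₀ Ts) → |t| < rA * (49 / 50 * θBal F.L γ b₀ p₀ Ts) →
            (∀ e, e ≠ b → V e = U e) → V b = U b * expPt (s • v) → (∀ e, e ≠ b' → Z e = V e) → Z b' = V b' * expPt (t • v') →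
            g ((s : ℂ), (t : ℂ)) = (((Real.log (ρ' Ts Z)) : ℝ) : ℂ)) ∧
          ∀ z ∈ Metric.ball (0 : ℂ) (rA * (49 / 50 * θBal F.L γ b₀ p₀ Ts)) ×ˢ Metric.ball (0 : ℂ) (rA * (49 / 50 * θBal F.L γ b₀ p₀ Ts)), ‖g z - g 0‖ ≤ Bρ')
    {Z : Type} (Φ : GaugeField (F.P j) 0 ↥(Matrix.specialUnitaryGroup (Fin 2) ℂ) × Z → GaugeField (F.P Ts) 0 ↥(Matrix.specialUnitaryGroup (Fin 2) ℂ))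
    (J : GaugeField (F.P j) 0 ↥(Matrix.specialUnitaryGroup (Fin 2) ℂ) × Z → ℝ≥0) (CJ : ℝ) (hJle : ∀ V z, (J (V, z) : ℝ) ≤ CJ)
    (t : ℝ) (ht0 : 0 ≤ t) (ht1 : t ≤ 1) (D KJ : ℝ≥0) {μ K δ : ℝ} (hδ : 0 < δ) (k : PBond (F.P Ts) 0 → ℝ) (hk0 : ∀ e, 0 ≤ k e) (hK : ∑ e, k e ≤ K)
    (hkμ : ∀ e, k e * δ ≤ μ) (hwin : 4 * (Real.sqrt 3 * μ) ≤ θBal F.L γ b₀ p₀ Ts / 50) (hrad : μ < rA * (49 / 50 * θBal F.L γ b₀ p₀ Ts))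
    (C : ℝ → GaugeField (F.P j) 0 ↥(Matrix.specialUnitaryGroup (Fin 2) ℂ)) (z : Z) (I : Set ℝ) (hI : Convex ℝ I)
    (hPc : ContinuousOn (fun s => wNum F γ b₀ p₀ j Ts ρ ρ' Φ J t (C s) z) I)
    (hdisp : ∀ x ∈ I, ∀ y ∈ I,
      (∀ r ∈ Set.uIoo x y, ∀ (n : ℕ) (hjn : j + 1 ≤ n) (hnK : n ≤ Ts), PlaqSmall (24 / 25 * θBal F.L γ b₀ p₀ n) (descendTo F ℰp n Ts hnK (Φ (C r, z)))) →
      ∀ (n : ℕ) (hjn : j + 1 ≤ n) (hnT : n ≤ Ts) (p : Plaq (F.P n) 0),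
        LipschitzOnWith D (fun s => dist1 (GaugeField.plaqHol (descendTo F ℰp n Ts hnT (Φ (C s, z))) p)) (I ∩ Set.uIcc x y))
    (hJ : ∀ x ∈ I, ∀ y ∈ I,
      (∀ r ∈ Set.uIoo x y, ∀ (n : ℕ) (hjn : j + 1 ≤ n) (hnK : n ≤ Ts), PlaqSmall (24 / 25 * θBal F.L γ b₀ p₀ n) (descendTo F ℰp n Ts hnK (Φ (C r, z)))) →
      LipschitzOnWith KJ (fun s => (J (C s, z) : ℝ)) (I ∩ Set.uIcc x y))
    (hincr : ∀ x ∈ I, ∀ y ∈ I,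
      (∀ r ∈ Set.uIoo x y, ∀ (n : ℕ) (hjn : j + 1 ≤ n) (hnK : n ≤ Ts), PlaqSmall (24 / 25 * θBal F.L γ b₀ p₀ n) (descendTo F ℰp n Ts hnK (Φ (C r, z)))) →
      ∀ s ∈ I ∩ Set.uIcc x y, ∀ s' ∈ I ∩ Set.uIcc x y, |s - s'| ≤ δ →
        ∀ e, ∃ w : Fin 3 → ℝ, Φ (C s', z) e = Φ (C s, z) e * expPt w ∧ ‖w‖ ≤ k e * |s - s'|) :
    LipschitzOnWith (((∑ i ∈ Finset.range (Ts - j), ∑ _p : Plaq (F.P (j + 1 + i)) 0, Real.toNNReal (1 / ((24 / 25 - 1 / 2) * θBal F.L γ b₀ p₀ (j + 1 + i))) * D)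
        * Real.toNNReal (Real.exp (ML + ML')) + Real.toNNReal 1 * (Real.toNNReal (Real.exp (ML + ML'))
          * (Real.toNNReal ((Bρ / rA) * (K / (49 / 50 * θBal F.L γ b₀ p₀ Ts))) + Real.toNNReal ((Bρ' / rA) * (K / (49 / 50 * θBal F.L γ b₀ p₀ Ts)))))) * Real.toNNReal CJ
        + Real.toNNReal (Real.exp (ML + ML')) * KJ)
      (fun s => wNum F γ b₀ p₀ j Ts ρ ρ' Φ J t (C s) z) I := by
  have hθT := hθ Ts
  refine lipschitzOnWith_of_continuousOn_of_openSeg hI hPc fun a ha b hb hfree => ?_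
  -- the interior of the segment runs inside the good set
  have hMW : ∀ r ∈ Set.uIoo a b, ∀ (n : ℕ) (hjn : j + 1 ≤ n) (hnK : n ≤ Ts),
      PlaqSmall (24 / 25 * θBal F.L γ b₀ p₀ n) (descendTo F ℰp n Ts hnK (Φ (C r, z))) :=
    fun r hr => hχsupp _ (mwCut_ne_zero_of_wNum_ne_zero F γ b₀ p₀ j Ts ρ ρ' Φ J t (C r) z (hfree r hr))
  set I' : Set ℝ := I ∩ Set.uIcc a b with hI'
  have hI'c : Convex ℝ I' := hI.inter (convex_uIcc a b)
  -- the two density letters on `I'`, in segment form, from (β) + local increments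
  have hLρ := abs_sub_le_of_beta_of_localIncr_seg (49 / 50 * θBal F.L γ b₀ p₀ Ts) rA Bρ (by positivity) hrA (fun U => Real.log (ρ Ts U)) hβ
    (θ₁ := 24 / 25 * θBal F.L γ b₀ p₀ Ts) hδ (fun s => Φ (C s, z)) I' hI'c k hk0 hK hkμ (hincr a ha b hb hMW) (by linarith) hrad
  have hLρ' := abs_sub_le_of_beta_of_localIncr_seg (49 / 50 * θBal F.L γ b₀ p₀ Ts) rA Bρ' (by positivity) hrA (fun U => Real.log (ρ' Ts U)) hβ'
    (θ₁ := 24 / 25 * θBal F.L γ b₀ p₀ Ts) hδ (fun s => Φ (C s, z)) I' hI'c k hk0 hK hkμ (hincr a ha b hb hMW) (by linarith) hrad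
  have hlip := lipschitzOnWith_wNum_of_chartLetters_seg F γ b₀ p₀ j Ts hjTs ρ ρ' hρpos hθ ML ML' hML hML' hχsupp Φ J CJ hJle t ht0 ht1
    D (Real.toNNReal ((Bρ / rA) * (K / (49 / 50 * θBal F.L γ b₀ p₀ Ts)))) (Real.toNNReal ((Bρ' / rA) * (K / (49 / 50 * θBal F.L γ b₀ p₀ Ts)))) KJ
    C z I' hI'c (hdisp a ha b hb hMW) hLρ hLρ' (hJ a ha b hb hMW)
  have h := (lipschitzOnWith_iff_dist_le_mul.1 hlip) a ⟨ha, Set.left_mem_uIcc⟩ b ⟨hb, Set.right_mem_uIcc⟩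
  rwa [Real.dist_eq, Real.dist_eq] at h

end Curve

/-! ## §2 The organ reading: (W-Lip) — paths AND squares — from the frame + (β)×2 + the three letters on good-interior segments -/

section Organ

/-- ★★★ **(W-Lip) FROM THE FRAME + (β) + GOOD-SET CHART LETTERS** — see the module docstring; conclusion = BOTH (W-Lip) clauses of ✓`ilawRegX∕V3∕Sq_of_weightLip` VERBATIM. [folklore] -/
theorem weightLip_of_beta_of_goodSetLetters (F : T3Family) (γ b₀ p₀ : ℝ) (j Ts : ℕ) (hjTs : j + 1 ≤ Ts)
    (ρ ρ' : (i : ℕ) → GaugeField (F.P i) 0 ↥(Matrix.specialUnitaryGroup (Fin 2) ℂ) → ℝ)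
    (hρc : ContinuousOn (ρ Ts) {U | PlaqSmall (θBal F.L γ b₀ p₀ Ts) U}) (hρ'c : ContinuousOn (ρ' Ts) {U | PlaqSmall (θBal F.L γ b₀ p₀ Ts) U})
    (hρpos : ∀ U, PlaqSmall (θBal F.L γ b₀ p₀ Ts) U → 0 < ρ Ts U ∧ 0 < ρ' Ts U) (hθ : ∀ n, 0 < θBal F.L γ b₀ p₀ n)
    (hχc : Continuous (mwCut F γ b₀ p₀ j Ts))
    (hχsupp : ∀ U, mwCut F γ b₀ p₀ j Ts U ≠ 0 → ∀ (n : ℕ) (hjn : j + 1 ≤ n) (hnK : n ≤ Ts), PlaqSmall (24 / 25 * θBal F.L γ b₀ p₀ n) (descendTo F ℰp n Ts hnK U))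
    (rA Bρ Bρ' : ℝ) (hrA : 0 < rA)
    (hβ : ∀ (U : GaugeField (F.P Ts) 0 ↥(Matrix.specialUnitaryGroup (Fin 2) ℂ)), PlaqSmall (49 / 50 * θBal F.L γ b₀ p₀ Ts) U →
      ∀ (b b' : PBond (F.P Ts) 0) (v v' : Fin 3 → ℝ), ‖v‖ ≤ 1 → ‖v'‖ ≤ 1 →
        ∃ g : ℂ × ℂ → ℂ, DifferentiableOn ℂ g (Metric.ball (0 : ℂ) (rA * (49 / 50 * θBal F.L γ b₀ p₀ Ts)) ×ˢ Metric.ball (0 : ℂ) (rA * (49 / 50 * θBal F.L γ b₀ p₀ Ts))) ∧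
          (∀ (s t : ℝ) (V Z : GaugeField (F.P Ts) 0 ↥(Matrix.specialUnitaryGroup (Fin 2) ℂ)), |s| < rA * (49 / 50 * θBal F.L γ b₀ p₀ Ts) → |t| < rA * (49 / 50 * θBal F.L γ b₀ p₀ Ts) →
            (∀ e, e ≠ b → V e = U e) → V b = U b * expPt (s • v) → (∀ e, e ≠ b' → Z e = V e) → Z b' = V b' * expPt (t • v') →
            g ((s : ℂ), (t : ℂ)) = (((Real.log (ρ Ts Z)) : ℝ) : ℂ)) ∧
          ∀ z ∈ Metric.ball (0 : ℂ) (rA * (49 / 50 * θBal F.L γ b₀ p₀ Ts)) ×ˢ Metric.ball (0 : ℂ) (rA * (49 / 50 * θBal F.L γ b₀ p₀ Ts)), ‖g z - g 0‖ ≤ Bρ)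
    (hβ' : ∀ (U : GaugeField (F.P Ts) 0 ↥(Matrix.specialUnitaryGroup (Fin 2) ℂ)), PlaqSmall (49 / 50 * θBal F.L γ b₀ p₀ Ts) U →
      ∀ (b b' : PBond (F.P Ts) 0) (v v' : Fin 3 → ℝ), ‖v‖ ≤ 1 → ‖v'‖ ≤ 1 →
        ∃ g : ℂ × ℂ → ℂ, DifferentiableOn ℂ g (Metric.ball (0 : ℂ) (rA * (49 / 50 * θBal F.L γ b₀ p₀ Ts)) ×ˢ Metric.ball (0 : ℂ) (rA * (49 / 50 * θBal F.L γ b₀ p₀ Ts))) ∧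
          (∀ (s t : ℝ) (V Z : GaugeField (F.P Ts) 0 ↥(Matrix.specialUnitaryGroup (Fin 2) ℂ)), |s| < rA * (49 / 50 * θBal F.L γ b₀ p₀ Ts) → |t| < rA * (49 / 50 * θBal F.L γ b₀ p₀ Ts) →
            (∀ e, e ≠ b → V e = U e) → V b = U b * expPt (s • v) → (∀ e, e ≠ b' → Z e = V e) → Z b' = V b' * expPt (t • v') →
            g ((s : ℂ), (t : ℂ)) = (((Real.log (ρ' Ts Z)) : ℝ) : ℂ)) ∧
          ∀ z ∈ Metric.ball (0 : ℂ) (rA * (49 / 50 * θBal F.L γ b₀ p₀ Ts)) ×ˢ Metric.ball (0 : ℂ) (rA * (49 / 50 * θBal F.L γ b₀ p₀ Ts)), ‖g z - g 0‖ ≤ Bρ')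
    {Z : Type} [MeasurableSpace Z] (τ : Measure Z)
    (Φ : GaugeField (F.P j) 0 ↥(Matrix.specialUnitaryGroup (Fin 2) ℂ) × Z → GaugeField (F.P Ts) 0 ↥(Matrix.specialUnitaryGroup (Fin 2) ℂ))
    (J : GaugeField (F.P j) 0 ↥(Matrix.specialUnitaryGroup (Fin 2) ℂ) × Z → ℝ≥0) (CJ : ℝ) (hJle : ∀ V z, (J (V, z) : ℝ) ≤ CJ)
    (hcont : ∀ f : GaugeField (F.P Ts) 0 ↥(Matrix.specialUnitaryGroup (Fin 2) ℂ) → ℝ, Continuous f →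
      (∀ U, f U ≠ 0 → (∀ (n : ℕ) (hjn : j + 1 ≤ n) (hnK : n ≤ Ts), PlaqSmall (24 / 25 * θBal F.L γ b₀ p₀ n) (descendTo F ℰp n Ts hnK U))) →
      ∀ z, ContinuousOn (fun V => (J (V, z) : ℝ) * f (Φ (V, z))) {V | PlaqSmall (θBal F.L γ b₀ p₀ j) V})
    (hθj : 0 < θBal F.L γ b₀ p₀ j) (rc : ℝ) (hrc : 0 ≤ rc) (hguard : (1 + 16 * Real.sqrt 3 * rc) * (θBal F.L γ b₀ p₀ j / 4) ≤ θBal F.L γ b₀ p₀ j)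
    (D KJ : ℝ≥0) {μ K δ : ℝ} (hδ : 0 < δ) (k : PBond (F.P Ts) 0 → ℝ) (hk0 : ∀ e, 0 ≤ k e) (hK : ∑ e, k e ≤ K)
    (hkμ : ∀ e, k e * δ ≤ μ) (hwin : 4 * (Real.sqrt 3 * μ) ≤ θBal F.L γ b₀ p₀ Ts / 50) (hrad : μ < rA * (49 / 50 * θBal F.L γ b₀ p₀ Ts))
    -- the three chart letters along near relational PATHS, on good-interior segments
    (hPdisp : ∀ (B' : PBond (F.P j) 0) (m' : Fin 3 → ℝ) (U₂ : GaugeField (F.P j) 0 ↥(Matrix.specialUnitaryGroup (Fin 2) ℂ))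
      (X : ℝ → GaugeField (F.P j) 0 ↥(Matrix.specialUnitaryGroup (Fin 2) ℂ)), ‖m'‖ ≤ rc * (θBal F.L γ b₀ p₀ j / 4) → PlaqSmall (θBal F.L γ b₀ p₀ j / 4) U₂ →
      (∀ s e, e ≠ B' → X s e = U₂ e) → (∀ s, X s B' = U₂ B' * expPt (s • m')) → ∀ (z : Z), ∀ x ∈ Set.Ioo (-1 : ℝ) 2, ∀ y ∈ Set.Ioo (-1 : ℝ) 2,
        (∀ r ∈ Set.uIoo x y, ∀ (n : ℕ) (hjn : j + 1 ≤ n) (hnK : n ≤ Ts), PlaqSmall (24 / 25 * θBal F.L γ b₀ p₀ n) (descendTo F ℰp n Ts hnK (Φ (X r, z)))) →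
        ∀ (n : ℕ) (hjn : j + 1 ≤ n) (hnT : n ≤ Ts) (p : Plaq (F.P n) 0),
          LipschitzOnWith D (fun s => dist1 (GaugeField.plaqHol (descendTo F ℰp n Ts hnT (Φ (X s, z))) p)) (Set.Ioo (-1 : ℝ) 2 ∩ Set.uIcc x y))
    (hPJ : ∀ (B' : PBond (F.P j) 0) (m' : Fin 3 → ℝ) (U₂ : GaugeField (F.P j) 0 ↥(Matrix.specialUnitaryGroup (Fin 2) ℂ))
      (X : ℝ → GaugeField (F.P j) 0 ↥(Matrix.specialUnitaryGroup (Fin 2) ℂ)), ‖m'‖ ≤ rc * (θBal F.L γ b₀ p₀ j / 4) → PlaqSmall (θBal F.L γ b₀ p₀ j / 4) U₂ →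
      (∀ s e, e ≠ B' → X s e = U₂ e) → (∀ s, X s B' = U₂ B' * expPt (s • m')) → ∀ (z : Z), ∀ x ∈ Set.Ioo (-1 : ℝ) 2, ∀ y ∈ Set.Ioo (-1 : ℝ) 2,
        (∀ r ∈ Set.uIoo x y, ∀ (n : ℕ) (hjn : j + 1 ≤ n) (hnK : n ≤ Ts), PlaqSmall (24 / 25 * θBal F.L γ b₀ p₀ n) (descendTo F ℰp n Ts hnK (Φ (X r, z)))) →
        LipschitzOnWith KJ (fun s => (J (X s, z) : ℝ)) (Set.Ioo (-1 : ℝ) 2 ∩ Set.uIcc x y))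
    (hPincr : ∀ (B' : PBond (F.P j) 0) (m' : Fin 3 → ℝ) (U₂ : GaugeField (F.P j) 0 ↥(Matrix.specialUnitaryGroup (Fin 2) ℂ))
      (X : ℝ → GaugeField (F.P j) 0 ↥(Matrix.specialUnitaryGroup (Fin 2) ℂ)), ‖m'‖ ≤ rc * (θBal F.L γ b₀ p₀ j / 4) → PlaqSmall (θBal F.L γ b₀ p₀ j / 4) U₂ →
      (∀ s e, e ≠ B' → X s e = U₂ e) → (∀ s, X s B' = U₂ B' * expPt (s • m')) → ∀ (z : Z), ∀ x ∈ Set.Ioo (-1 : ℝ) 2, ∀ y ∈ Set.Ioo (-1 : ℝ) 2,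
        (∀ r ∈ Set.uIoo x y, ∀ (n : ℕ) (hjn : j + 1 ≤ n) (hnK : n ≤ Ts), PlaqSmall (24 / 25 * θBal F.L γ b₀ p₀ n) (descendTo F ℰp n Ts hnK (Φ (X r, z)))) →
        ∀ s ∈ Set.Ioo (-1 : ℝ) 2 ∩ Set.uIcc x y, ∀ s' ∈ Set.Ioo (-1 : ℝ) 2 ∩ Set.uIcc x y, |s - s'| ≤ δ →
          ∀ e, ∃ w : Fin 3 → ℝ, Φ (X s', z) e = Φ (X s, z) e * expPt w ∧ ‖w‖ ≤ k e * |s - s'|)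
    -- the same along the `s`-edges of near relational SQUARES
    (hSdisp : ∀ (B B' : PBond (F.P j) 0) (m m' : Fin 3 → ℝ) (V00 : GaugeField (F.P j) 0 ↥(Matrix.specialUnitaryGroup (Fin 2) ℂ))
      (Y : ℝ → GaugeField (F.P j) 0 ↥(Matrix.specialUnitaryGroup (Fin 2) ℂ)) (X : ℝ → ℝ → GaugeField (F.P j) 0 ↥(Matrix.specialUnitaryGroup (Fin 2) ℂ)),
      ‖m‖ ≤ rc * (θBal F.L γ b₀ p₀ j / 4) → ‖m'‖ ≤ rc * (θBal F.L γ b₀ p₀ j / 4) → PlaqSmall (θBal F.L γ b₀ p₀ j / 4) V00 →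
      (∀ s e, e ≠ B → Y s e = V00 e) → (∀ s, Y s B = V00 B * expPt (s • m)) → (∀ s s' e, e ≠ B' → X s s' e = Y s e) → (∀ s s', X s s' B' = Y s B' * expPt (s' • m')) →
      ∀ s' ∈ Set.Icc (0:ℝ) 1, ∀ (z : Z), ∀ x ∈ Set.Ioo (-1 : ℝ) 2, ∀ y ∈ Set.Ioo (-1 : ℝ) 2,
        (∀ r ∈ Set.uIoo x y, ∀ (n : ℕ) (hjn : j + 1 ≤ n) (hnK : n ≤ Ts), PlaqSmall (24 / 25 * θBal F.L γ b₀ p₀ n) (descendTo F ℰp n Ts hnK (Φ (X r s', z)))) →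
        ∀ (n : ℕ) (hjn : j + 1 ≤ n) (hnT : n ≤ Ts) (p : Plaq (F.P n) 0),
          LipschitzOnWith D (fun s => dist1 (GaugeField.plaqHol (descendTo F ℰp n Ts hnT (Φ (X s s', z))) p)) (Set.Ioo (-1 : ℝ) 2 ∩ Set.uIcc x y))
    (hSJ : ∀ (B B' : PBond (F.P j) 0) (m m' : Fin 3 → ℝ) (V00 : GaugeField (F.P j) 0 ↥(Matrix.specialUnitaryGroup (Fin 2) ℂ))
      (Y : ℝ → GaugeField (F.P j) 0 ↥(Matrix.specialUnitaryGroup (Fin 2) ℂ)) (X : ℝ → ℝ → GaugeField (F.P j) 0 ↥(Matrix.specialUnitaryGroup (Fin 2) ℂ)),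
      ‖m‖ ≤ rc * (θBal F.L γ b₀ p₀ j / 4) → ‖m'‖ ≤ rc * (θBal F.L γ b₀ p₀ j / 4) → PlaqSmall (θBal F.L γ b₀ p₀ j / 4) V00 →
      (∀ s e, e ≠ B → Y s e = V00 e) → (∀ s, Y s B = V00 B * expPt (s • m)) → (∀ s s' e, e ≠ B' → X s s' e = Y s e) → (∀ s s', X s s' B' = Y s B' * expPt (s' • m')) →
      ∀ s' ∈ Set.Icc (0:ℝ) 1, ∀ (z : Z), ∀ x ∈ Set.Ioo (-1 : ℝ) 2, ∀ y ∈ Set.Ioo (-1 : ℝ) 2,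
        (∀ r ∈ Set.uIoo x y, ∀ (n : ℕ) (hjn : j + 1 ≤ n) (hnK : n ≤ Ts), PlaqSmall (24 / 25 * θBal F.L γ b₀ p₀ n) (descendTo F ℰp n Ts hnK (Φ (X r s', z)))) →
        LipschitzOnWith KJ (fun s => (J (X s s', z) : ℝ)) (Set.Ioo (-1 : ℝ) 2 ∩ Set.uIcc x y))
    (hSincr : ∀ (B B' : PBond (F.P j) 0) (m m' : Fin 3 → ℝ) (V00 : GaugeField (F.P j) 0 ↥(Matrix.specialUnitaryGroup (Fin 2) ℂ))
      (Y : ℝ → GaugeField (F.P j) 0 ↥(Matrix.specialUnitaryGroup (Fin 2) ℂ)) (X : ℝ → ℝ → GaugeField (F.P j) 0 ↥(Matrix.specialUnitaryGroup (Fin 2) ℂ)),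
      ‖m‖ ≤ rc * (θBal F.L γ b₀ p₀ j / 4) → ‖m'‖ ≤ rc * (θBal F.L γ b₀ p₀ j / 4) → PlaqSmall (θBal F.L γ b₀ p₀ j / 4) V00 →
      (∀ s e, e ≠ B → Y s e = V00 e) → (∀ s, Y s B = V00 B * expPt (s • m)) → (∀ s s' e, e ≠ B' → X s s' e = Y s e) → (∀ s s', X s s' B' = Y s B' * expPt (s' • m')) →
      ∀ s' ∈ Set.Icc (0:ℝ) 1, ∀ (z : Z), ∀ x ∈ Set.Ioo (-1 : ℝ) 2, ∀ y ∈ Set.Ioo (-1 : ℝ) 2,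
        (∀ r ∈ Set.uIoo x y, ∀ (n : ℕ) (hjn : j + 1 ≤ n) (hnK : n ≤ Ts), PlaqSmall (24 / 25 * θBal F.L γ b₀ p₀ n) (descendTo F ℰp n Ts hnK (Φ (X r s', z)))) →
        ∀ s ∈ Set.Ioo (-1 : ℝ) 2 ∩ Set.uIcc x y, ∀ s'' ∈ Set.Ioo (-1 : ℝ) 2 ∩ Set.uIcc x y, |s - s''| ≤ δ →
          ∀ e, ∃ w : Fin 3 → ℝ, Φ (X s'' s', z) e = Φ (X s s', z) e * expPt w ∧ ‖w‖ ≤ k e * |s - s''|) :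
    ∃ bW : ℝ, ∀ t : ℝ, 0 ≤ t → t ≤ 1 →
      (∀ (B' : PBond (F.P j) 0) (m' : Fin 3 → ℝ) (U₂ : GaugeField (F.P j) 0 ↥(Matrix.specialUnitaryGroup (Fin 2) ℂ))
        (X : ℝ → GaugeField (F.P j) 0 ↥(Matrix.specialUnitaryGroup (Fin 2) ℂ)), ‖m'‖ ≤ rc * (θBal F.L γ b₀ p₀ j / 4) → PlaqSmall (θBal F.L γ b₀ p₀ j / 4) U₂ →
        (∀ s e, e ≠ B' → X s e = U₂ e) → (∀ s, X s B' = U₂ B' * expPt (s • m')) →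
        ∀ᵐ z ∂τ, LipschitzOnWith (Real.nnabs bW) (fun s => wNum F γ b₀ p₀ j Ts ρ ρ' Φ J t (X s) z) (Set.Ioo (-1) 2)) ∧
      (∀ (B B' : PBond (F.P j) 0) (m m' : Fin 3 → ℝ) (V00 : GaugeField (F.P j) 0 ↥(Matrix.specialUnitaryGroup (Fin 2) ℂ))
        (Y : ℝ → GaugeField (F.P j) 0 ↥(Matrix.specialUnitaryGroup (Fin 2) ℂ)) (X : ℝ → ℝ → GaugeField (F.P j) 0 ↥(Matrix.specialUnitaryGroup (Fin 2) ℂ)),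
        ‖m‖ ≤ rc * (θBal F.L γ b₀ p₀ j / 4) → ‖m'‖ ≤ rc * (θBal F.L γ b₀ p₀ j / 4) → PlaqSmall (θBal F.L γ b₀ p₀ j / 4) V00 →
        (∀ s e, e ≠ B → Y s e = V00 e) → (∀ s, Y s B = V00 B * expPt (s • m)) → (∀ s s' e, e ≠ B' → X s s' e = Y s e) → (∀ s s', X s s' B' = Y s B' * expPt (s' • m')) →
        ∀ s' ∈ Set.Icc (0:ℝ) 1, ∀ᵐ z ∂τ, LipschitzOnWith (Real.nnabs bW) (fun s => wNum F γ b₀ p₀ j Ts ρ ρ' Φ J t (X s s') z) (Set.Ioo (-1) 2)) := by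
  have hθT := hθ Ts
  obtain ⟨ML, hML⟩ := exists_abs_log_le_of_plaq_le F γ b₀ p₀ Ts (ρ Ts) hρc (fun U hU => (hρpos U hU).1) hθT
  obtain ⟨ML', hML'⟩ := exists_abs_log_le_of_plaq_le F γ b₀ p₀ Ts (ρ' Ts) hρ'c (fun U hU => (hρpos U hU).2) hθT
  set Kbig : ℝ≥0 := ((∑ i ∈ Finset.range (Ts - j), ∑ _p : Plaq (F.P (j + 1 + i)) 0, Real.toNNReal (1 / ((24 / 25 - 1 / 2) * θBal F.L γ b₀ p₀ (j + 1 + i))) * D)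
        * Real.toNNReal (Real.exp (ML + ML')) + Real.toNNReal 1 * (Real.toNNReal (Real.exp (ML + ML'))
          * (Real.toNNReal ((Bρ / rA) * (K / (49 / 50 * θBal F.L γ b₀ p₀ Ts))) + Real.toNNReal ((Bρ' / rA) * (K / (49 / 50 * θBal F.L γ b₀ p₀ Ts)))))) * Real.toNNReal CJ
        + Real.toNNReal (Real.exp (ML + ML')) * KJ with hKdef
  have hKabs : Real.nnabs (Kbig : ℝ) = Kbig := by ext; rw [Real.coe_nnabs, abs_of_nonneg (NNReal.coe_nonneg Kbig)]
  refine ⟨(Kbig : ℝ), fun t ht0 ht1 => ⟨?_, ?_⟩⟩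
  · intro B' m' U₂ X hm' hU₂ hoff hon
    refine ae_of_all τ fun z => ?_
    rw [hKabs]
    exact lipschitzOnWith_wNum_of_goodSetLetters F γ b₀ p₀ j Ts hjTs ρ ρ' hρpos hθ ML ML' hML hML' hχsupp rA Bρ Bρ' hrA hβ hβ' Φ J CJ hJle t ht0 ht1
      D KJ hδ k hk0 hK hkμ hwin hrad X z (Set.Ioo (-1) 2) (convex_Ioo (-1 : ℝ) 2)
      (continuousOn_wNum_relPath F γ b₀ p₀ j Ts hjTs ρ ρ' hρc hρ'c hρpos hθT hχc hχsupp Φ J hcont hθj rc hrc hguard t B' m' U₂ X hm' hU₂ hoff hon z)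
      (hPdisp B' m' U₂ X hm' hU₂ hoff hon z) (hPJ B' m' U₂ X hm' hU₂ hoff hon z) (hPincr B' m' U₂ X hm' hU₂ hoff hon z)
  · intro B B' m m' V00 Y X hm hm' hV hYoff hYon hXoff hXon s' hs'
    refine ae_of_all τ fun z => ?_
    rw [hKabs]
    exact lipschitzOnWith_wNum_of_goodSetLetters F γ b₀ p₀ j Ts hjTs ρ ρ' hρpos hθ ML ML' hML hML' hχsupp rA Bρ Bρ' hrA hβ hβ' Φ J CJ hJle t ht0 ht1
      D KJ hδ k hk0 hK hkμ hwin hrad (fun s => X s s') z (Set.Ioo (-1) 2) (convex_Ioo (-1 : ℝ) 2)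
      (continuousOn_wNum_relSquare F γ b₀ p₀ j Ts hjTs ρ ρ' hρc hρ'c hρpos hθT hχc hχsupp Φ J hcont rc hguard t B B' m m' V00 Y X hm hm' hV hYoff hYon hXoff hXon hs' z)
      (hSdisp B B' m m' V00 Y X hm hm' hV hYoff hYon hXoff hXon s' hs' z) (hSJ B B' m m' V00 Y X hm hm' hV hYoff hYon hXoff hXon s' hs' z)
      (hSincr B B' m m' V00 Y X hm hm' hV hYoff hYon hXoff hXon s' hs' z)

end Organ

end Summit.QuantumFields.YangMills.Theorems.OrganTangentWeightLipOfGoodSetLetters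

end
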